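import Summits.QuantumFields.YangMills.Theorems.AllWindowsColdBoxBoxHighLineAssemblyEpsTwoBudget

/-!
# U5 final bookkeeping, part 1 (third order) — the ε₂ ARITHMETIC with five error pieces and the size-independent LARGENESS ROWS at the U5 window
# (planner ym-idea-2 g18, `Cruxes/BoxWindowHighSU2213/ASSEMBLY-U5.md` v0.2 §3 «(ε₂ bookkeeping) as ✓…AssemblyEpsTwoBudget with three more rows … an
# `eps_two_arith_third`-type lemma, then ε₂ = 1/8»; LINE-20 U5 ⟨stmt-QuantumFields-24336⟩; U5 prep, helper-grade; U5 OPEN)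

Width seat `ym-line-sfw-p2-w2` (g33).  Pure real arithmetic, no measure theory (pattern = w3 g40's ✓`AssemblyFinal.eps_two_arith` + ✓`AssemblyBudget.*` for S5):

* ★`AssemblyFinal.eps_two_arith_third` — the ε₂-half of ✓`landauRelativeComparisonBulk_of_split` at THIRD order has FIVE pieces: the cut-set restriction at `t = 1`
  (✓`GaussNormalForm.abs_chartCov_sub_tiltCov_muCut_one_le_chartPlaqCost`: `|Cov^{w_J}_D − tc₁| ≤ 96τ_c`), the third-order Taylor remainder
  (✓13u³ `abs_tiltCov_sub_sub_tiltCum3_sub_half_tiltCum4_le…`: `|tc₁ − tc₀ − κ₃ − κ₄/2| ≤ K₅/6`), the EXACT third and fourth cumulants at `t = 0` (`|κ₃| ≤ K₃`, `|κ₄| ≤ K₄`,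
  L2/L3c sizes) and the `t = 0` end (✓13f₀′ `abs_sq_mul_tiltCov_muSet_zero_sub_main_le`: `|β²tc₀ − main| ≤ F₀`); if each piece times `β²H⁸` is `≤ e` and the floor gives
  `40e/H⁸ ≤ main`, then `|β²·Cov^{w_J}_D − main| ≤ main/8` (so `e := (4/5)·3/(1024π⁴)` with ✓`BoxToChart.boxDirCircSqCov_floor_H`);  `f0_le_of_tau_le` (monotonicity of the 13f₀ shape);
* the rows that do NOT depend on the L2/L3c sizes (all `∃ β₀, ∀ β ≥ β₀, ∀ H, 1 ≤ H → H ≤ β^θ + 1 → … ≤ ε`, via ✓`AssemblyBudget.budget_monomial`):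
  `cut_budget` (`β²H⁸·96β^{−q} ≤ ε` iff `8θ + 2 < q` — the FP-side cut mass of ✓`exists_beta0_cubicCut`), `tau2_poly_budget` (`96·4^r(2r−1)^{3r}(CH⁴L³/β)^r·β²·H⁸ ≤ ε` whenever
  `(8 + 4r)θ + 2 < r`, e.g. `r = 5` for `θ < 3/28` — the polynomial part of the Gaussian-side co-mass `τ″` of ✓`gaussAvg_one_sub_indicator_cutSet_le`; its exponential part and
  `C_f/β` are ✓`f0_budget`), `shift_budget` (the premise `C·β·H⁴·s⁵ ≤ 1/2` of the τ″ lemma: `4θ + 5κ₃ < 3/2`), `k5_budget` (w5 g24's ✓`exists_beta0_abs_tiltCum5_muD_le` shape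
  `C·L^m·((L²/β² + s³/(β√β))·H⁶/(β√β))` times `β²H⁸/6`: `14θ < 3/2` and `14θ + 3κ₃ < 5/2`); the side conditions are ✓`side_budget` verbatim (it only needs `2θ < 1/2 − κ₃`).
  The two EXACT-cumulant rows wait for the posted L2 (w3 g41) / L3c (LEAD g78) size statements (to be appended).

HONEST LABEL: arithmetic for the OPEN (UNSTAFFED) third-order assembly `landauThirdOrder_of` of the XL stub U5 of a critic-PASSed DRAFT line; U5, ⟨24336⟩, ⟨24004⟩ and the seat's
own crux ⟨22884⟩ remain OPEN; no crux, rung or summit is proved; **the Yang–Mills mass gap is NOT proved by this file; no summit is proved by a line.**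
-/

set_option autoImplicit false

noncomputable section

namespace Summit.QuantumFields.YangMills.Theorems.AllWindowsColdBoxBoxHighLine

/-! ## The third-order ε₂ arithmetic -/

namespace AssemblyFinal

/-- ★ **The ε₂ arithmetic at third order**: five error pieces, each `≤ e/H⁸` after multiplication by `β²`, and the floor `40e/H⁸ ≤ main` give
`|β²·cc − main| ≤ (1/8)·main` (`cc` = the FP-chart covariance over `D`, `tc₁`/`tc₀` = the tilted covariances over `μ_{D′}` at `t = 1`/`t = 0`,
`k₃`, `k₄` = the third/fourth cumulants at `t = 0`). -/
theorem eps_two_arith_third {cc tc₁ tc₀ k₃ k₄ main K₅ K₃ K₄ F₀ τc e H8 β : ℝ} (hH8 : 0 < H8)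
    (hC : |cc - tc₁| ≤ 96 * τc) (h13u : |tc₁ - tc₀ - k₃ - k₄ / 2| ≤ K₅ / 6) (hK3 : |k₃| ≤ K₃) (hK4 : |k₄| ≤ K₄) (hf0 : |β ^ 2 * tc₀ - main| ≤ F₀)
    (bC : β ^ 2 * H8 * (96 * τc) ≤ e) (bK5 : β ^ 2 * H8 * (K₅ / 6) ≤ e) (bK3 : β ^ 2 * H8 * K₃ ≤ e) (bK4 : β ^ 2 * H8 * (K₄ / 2) ≤ e)
    (bf0 : F₀ * H8 ≤ e) (hfloor : 40 * e / H8 ≤ main) : |β ^ 2 * cc - main| ≤ 1 / 8 * main := by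
  have hβ2 : 0 ≤ β ^ 2 := sq_nonneg β
  have hsplit : β ^ 2 * cc - main =
      β ^ 2 * (cc - tc₁) + β ^ 2 * (tc₁ - tc₀ - k₃ - k₄ / 2) + β ^ 2 * k₃ + β ^ 2 * (k₄ / 2) + (β ^ 2 * tc₀ - main) := by ring
  have h1 : |β ^ 2 * cc - main| ≤
      β ^ 2 * |cc - tc₁| + β ^ 2 * |tc₁ - tc₀ - k₃ - k₄ / 2| + β ^ 2 * |k₃| + β ^ 2 * (|k₄| / 2) + |β ^ 2 * tc₀ - main| := by
    rw [hsplit]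
    have e1 : |β ^ 2 * (cc - tc₁)| = β ^ 2 * |cc - tc₁| := by rw [abs_mul, abs_of_nonneg hβ2]
    have e2 : |β ^ 2 * (tc₁ - tc₀ - k₃ - k₄ / 2)| = β ^ 2 * |tc₁ - tc₀ - k₃ - k₄ / 2| := by rw [abs_mul, abs_of_nonneg hβ2]
    have e3 : |β ^ 2 * k₃| = β ^ 2 * |k₃| := by rw [abs_mul, abs_of_nonneg hβ2]
    have e4 : |β ^ 2 * (k₄ / 2)| = β ^ 2 * (|k₄| / 2) := by rw [abs_mul, abs_of_nonneg hβ2, abs_div, abs_two]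
    calc _ ≤ |β ^ 2 * (cc - tc₁) + β ^ 2 * (tc₁ - tc₀ - k₃ - k₄ / 2) + β ^ 2 * k₃ + β ^ 2 * (k₄ / 2)| + |β ^ 2 * tc₀ - main| := abs_add_le _ _
      _ ≤ |β ^ 2 * (cc - tc₁) + β ^ 2 * (tc₁ - tc₀ - k₃ - k₄ / 2) + β ^ 2 * k₃| + |β ^ 2 * (k₄ / 2)| + |β ^ 2 * tc₀ - main| := by
          gcongr; exact abs_add_le _ _
      _ ≤ |β ^ 2 * (cc - tc₁) + β ^ 2 * (tc₁ - tc₀ - k₃ - k₄ / 2)| + |β ^ 2 * k₃| + |β ^ 2 * (k₄ / 2)| + |β ^ 2 * tc₀ - main| := by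
          gcongr; exact abs_add_le _ _
      _ ≤ |β ^ 2 * (cc - tc₁)| + |β ^ 2 * (tc₁ - tc₀ - k₃ - k₄ / 2)| + |β ^ 2 * k₃| + |β ^ 2 * (k₄ / 2)| + |β ^ 2 * tc₀ - main| := by
          gcongr; exact abs_add_le _ _
      _ = _ := by rw [e1, e2, e3, e4]
  -- each piece is `≤ e / H8`
  have p1 : β ^ 2 * |cc - tc₁| ≤ e / H8 := by
    rw [le_div_iff₀ hH8]
    calc β ^ 2 * |cc - tc₁| * H8 ≤ β ^ 2 * (96 * τc) * H8 := mul_le_mul_of_nonneg_right (mul_le_mul_of_nonneg_left hC hβ2) hH8.le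
      _ = β ^ 2 * H8 * (96 * τc) := by ring
      _ ≤ e := bC
  have p2 : β ^ 2 * |tc₁ - tc₀ - k₃ - k₄ / 2| ≤ e / H8 := by
    rw [le_div_iff₀ hH8]
    calc β ^ 2 * |tc₁ - tc₀ - k₃ - k₄ / 2| * H8 ≤ β ^ 2 * (K₅ / 6) * H8 :=
          mul_le_mul_of_nonneg_right (mul_le_mul_of_nonneg_left h13u hβ2) hH8.le
      _ = β ^ 2 * H8 * (K₅ / 6) := by ring
      _ ≤ e := bK5
  have p3 : β ^ 2 * |k₃| ≤ e / H8 := by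
    rw [le_div_iff₀ hH8]
    calc β ^ 2 * |k₃| * H8 ≤ β ^ 2 * K₃ * H8 := mul_le_mul_of_nonneg_right (mul_le_mul_of_nonneg_left hK3 hβ2) hH8.le
      _ = β ^ 2 * H8 * K₃ := by ring
      _ ≤ e := bK3
  have p4 : β ^ 2 * (|k₄| / 2) ≤ e / H8 := by
    rw [le_div_iff₀ hH8]
    calc β ^ 2 * (|k₄| / 2) * H8 ≤ β ^ 2 * (K₄ / 2) * H8 :=
          mul_le_mul_of_nonneg_right (mul_le_mul_of_nonneg_left (by linarith) hβ2) hH8.le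
      _ = β ^ 2 * H8 * (K₄ / 2) := by ring
      _ ≤ e := bK4
  have p5 : |β ^ 2 * tc₀ - main| ≤ e / H8 := by
    rw [le_div_iff₀ hH8]
    exact (mul_le_mul_of_nonneg_right hf0 hH8.le).trans bf0
  have h5 : |β ^ 2 * cc - main| ≤ 5 * (e / H8) := by linarith
  have h6 : 5 * (e / H8) = 1 / 8 * (40 * e / H8) := by ring
  have hmain : 0 ≤ main := by
    have h0 : 0 ≤ |β ^ 2 * cc - main| := abs_nonneg _
    nlinarith
  nlinarith

/-- The 13f₀/13f₀′ error shape is monotone in the co-mass: `τ ≤ τ_b` ⇒ `96τβ² + C/β ≤ 96τ_bβ² + C/β`. -/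
theorem f0_le_of_tau_le {τ τb β C : ℝ} (hτ : τ ≤ τb) : 96 * τ * β ^ 2 + C / β ≤ 96 * τb * β ^ 2 + C / β := by
  nlinarith [sq_nonneg β]

/-- Splitting a co-mass `τ″ = τ_exp + τ_poly` inside the 13f₀′ shape: `96(τ₁ + τ₂)β² + C/β = (96τ₁β² + C/β) + 96τ₂β²` (so ✓`f0_budget` handles the first bracket
and `tau2_poly_budget` the second summand). -/
theorem f0_shape_split (τ₁ τ₂ β C H8 : ℝ) :
    (96 * (τ₁ + τ₂) * β ^ 2 + C / β) * H8 = (96 * τ₁ * β ^ 2 + C / β) * H8 + 96 * τ₂ * β ^ 2 * H8 := by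
  ring

end AssemblyFinal

/-! ## Size-independent largeness rows at the U5 window -/

namespace AssemblyBudget

open ErrorBudget

/-- **Cut row** (the FP-side cut mass `τ_c = β^{−q}` of ✓`SmallFieldFP.exists_beta0_cubicCut` inside `eps_two_arith_third`): if `8θ + 2 < q` then
`β²·H⁸·(96·β^{−q}) ≤ ε` for `β ≥ β₀`, `1 ≤ H ≤ β^θ + 1`. -/
theorem cut_budget {θ q ε : ℝ} (hθ : 0 ≤ θ) (hq : 8 * θ + 2 < q) (hε : 0 < ε) :
    ∃ β₀ : ℝ, 1 ≤ β₀ ∧ ∀ β : ℝ, β₀ ≤ β → ∀ H : ℕ, 1 ≤ H → (H : ℝ) ≤ β ^ θ + 1 →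
      β ^ 2 * (H : ℝ) ^ 8 * (96 * β ^ (-q)) ≤ ε := by
  obtain ⟨β₀, hβ₀, h⟩ := budget_monomial (a := 2 - q) (k := 8) (j := 0) (κ₃ := 0) hθ (by push_cast; linarith) hε 96 0
  refine ⟨β₀, hβ₀, fun β hβ H hH hHβ => ?_⟩
  have hβpos : 0 < β := by linarith
  have h1 := h β hβ H hH hHβ
  simp only [pow_zero, mul_one] at h1
  have hid : β ^ 2 * (H : ℝ) ^ 8 * (96 * β ^ (-q)) = 96 * (H : ℝ) ^ 8 * β ^ (2 - q) := by
    rw [sub_eq_add_neg, Real.rpow_add hβpos, Real.rpow_two]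
    ring
  rw [hid]
  exact h1

/-- `(C·H⁴·L³/β)^r = C^r·H^{4r}·L^{3r}·β^{−r}` for `β > 0`. -/
theorem cubicTail_pow_eq {C L β : ℝ} {H : ℕ} (hβ : 0 < β) (r : ℕ) :
    (C * (H : ℝ) ^ 4 * L ^ 3 / β) ^ r = C ^ r * (H : ℝ) ^ (4 * r) * L ^ (3 * r) * β ^ (-(r : ℝ)) := by
  rw [div_pow, mul_pow, mul_pow, ← pow_mul, ← pow_mul, Real.rpow_neg hβ.le, Real.rpow_natCast, div_eq_mul_inv]

/-- **τ″ polynomial row** (the moment part of the Gaussian-side co-mass of the cut set, ✓`GaussRestrict.gaussAvg_one_sub_indicator_cutSet_le`, inside the 13f₀′ piece):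
if `(8 + 4r)θ + 2 < r` (e.g. `r = 5` and `θ < 3/28`) then `96·(4^r·((2r−1)^{3r}·(C·H⁴·(1+log H)³/β)^r))·β²·H⁸ ≤ ε` for `β ≥ β₀`, `1 ≤ H ≤ β^θ + 1`. -/
theorem tau2_poly_budget {θ ε : ℝ} {r : ℕ} (hθ : 0 ≤ θ) (hr : (8 + 4 * (r : ℝ)) * θ + 2 < r) (hε : 0 < ε) (C : ℝ) :
    ∃ β₀ : ℝ, 1 ≤ β₀ ∧ ∀ β : ℝ, β₀ ≤ β → ∀ H : ℕ, 1 ≤ H → (H : ℝ) ≤ β ^ θ + 1 →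
      96 * ((4 : ℝ) ^ r * ((2 * r - 1 : ℝ) ^ (r * 3) * (C * (H : ℝ) ^ 4 * (1 + Real.log H) ^ 3 / β) ^ r)) * β ^ 2 * (H : ℝ) ^ 8 ≤ ε := by
  obtain ⟨β₀, hβ₀, h⟩ := budget_monomial (a := 2 - r) (k := 8 + 4 * r) (j := 0) (κ₃ := 0) hθ (by push_cast; linarith) hε
    (96 * (4 : ℝ) ^ r * (2 * r - 1 : ℝ) ^ (r * 3) * C ^ r) (3 * r)
  refine ⟨β₀, hβ₀, fun β hβ H hH hHβ => ?_⟩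
  have hβpos : 0 < β := by linarith
  have h1 := h β hβ H hH hHβ
  simp only [pow_zero, mul_one] at h1
  have hβr : β ^ ((2 : ℝ) - r) = β ^ 2 * β ^ (-(r : ℝ)) := by
    rw [sub_eq_add_neg, Real.rpow_add hβpos, Real.rpow_two]
  have hid : 96 * ((4 : ℝ) ^ r * ((2 * r - 1 : ℝ) ^ (r * 3) * (C * (H : ℝ) ^ 4 * (1 + Real.log H) ^ 3 / β) ^ r)) * β ^ 2 * (H : ℝ) ^ 8 =
      96 * (4 : ℝ) ^ r * (2 * r - 1 : ℝ) ^ (r * 3) * C ^ r * (H : ℝ) ^ (8 + 4 * r) * (1 + Real.log H) ^ (3 * r) * β ^ ((2 : ℝ) - r) := by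
    rw [cubicTail_pow_eq hβpos, hβr, pow_add]
    ring
  rw [hid]
  exact h1

/-- **Shift row** (the premise `C·β·H⁴·s⁵ ≤ 1/2` of the τ″ lemma, `s = β^{κ₃−1/2}`): eventually true whenever `4θ + 5κ₃ < 3/2`. -/
theorem shift_budget {θ κ₃ : ℝ} (hθ : 0 ≤ θ) (h : 4 * θ + 5 * κ₃ < 3 / 2) (C : ℝ) :
    ∃ β₀ : ℝ, 1 ≤ β₀ ∧ ∀ β : ℝ, β₀ ≤ β → ∀ H : ℕ, 1 ≤ H → (H : ℝ) ≤ β ^ θ + 1 →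
      C * β * (H : ℝ) ^ 4 * (β ^ (κ₃ - 1 / 2)) ^ 5 ≤ 1 / 2 := by
  obtain ⟨β₀, hβ₀, hb⟩ := budget_monomial (a := 1) (k := 4) (j := 5) (κ₃ := κ₃) hθ (by push_cast; linarith) (by norm_num : (0 : ℝ) < 1 / 2) C 0
  refine ⟨β₀, hβ₀, fun β hβ H hH hHβ => ?_⟩
  have h1 := hb β hβ H hH hHβ
  simp only [pow_zero, mul_one, Real.rpow_one] at h1
  calc C * β * (H : ℝ) ^ 4 * (β ^ (κ₃ - 1 / 2)) ^ 5 = C * (H : ℝ) ^ 4 * (β ^ (κ₃ - 1 / 2)) ^ 5 * β := by ring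
    _ ≤ 1 / 2 := h1

/-- The algebra of the κ₅ row: `β²h⁸/6 · C·L^m·((L²/β² + s³/(β√β))·(h⁶/(β√β))) = C/6·h¹⁴·L^{m+2}/(β√β) + C/6·h¹⁴·L^m·s³/β` (`β > 0`). -/
theorem k5_shape_eq {β s L C h : ℝ} (m : ℕ) (hβ : 0 < β) :
    β ^ 2 * h ^ 8 / 6 * (C * L ^ m * ((L ^ 2 / β ^ 2 + s ^ 3 / (β * Real.sqrt β)) * (h ^ 6 / (β * Real.sqrt β)))) =
      C / 6 * h ^ 14 * L ^ (m + 2) / (β * Real.sqrt β) + C / 6 * h ^ 14 * L ^ m * s ^ 3 / β := by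
  have hq : 0 < Real.sqrt β := Real.sqrt_pos.2 hβ
  have hβq : β = Real.sqrt β ^ 2 := (Real.sq_sqrt hβ.le).symm
  set q := Real.sqrt β with hq_def
  rw [hβq]
  field_simp
  ring

/-- `β^{−3/2} = 1/(β√β)` and `β^{−1} = 1/β` (`β > 0`). -/
theorem rpow_neg_three_halves_eq {β : ℝ} (hβ : 0 < β) : β ^ (-(3 / 2 : ℝ)) = 1 / (β * Real.sqrt β) := by
  rw [Real.rpow_neg hβ.le, Real.sqrt_eq_rpow, ← Real.rpow_one_add' hβ.le (by norm_num), one_div]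
  norm_num

/-- **κ₅ row** (w5 g24's ✓`GaussNormalForm.exists_beta0_abs_tiltCum5_muD_le` shape times `β²H⁸/6`): if `14θ < 3/2` and `14θ + 3κ₃ < 5/2` then
`β²·H⁸/6 · C·L^m·((L²/β² + s³/(β√β))·(H⁶/(β√β))) ≤ ε` eventually (`s = β^{κ₃−1/2}`, `L = 1 + log H`). -/
theorem k5_budget {θ κ₃ ε : ℝ} (hθ : 0 ≤ θ) (h14 : 14 * θ < 3 / 2) (h14' : 14 * θ + 3 * κ₃ < 5 / 2) (hε : 0 < ε) (C : ℝ) (m : ℕ) :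
    ∃ β₀ : ℝ, 1 ≤ β₀ ∧ ∀ β : ℝ, β₀ ≤ β → ∀ H : ℕ, 1 ≤ H → (H : ℝ) ≤ β ^ θ + 1 →
      β ^ 2 * (H : ℝ) ^ 8 / 6 *
          (C * (1 + Real.log H) ^ m *
            (((1 + Real.log H) ^ 2 / β ^ 2 + (β ^ (κ₃ - 1 / 2)) ^ 3 / (β * Real.sqrt β)) * ((H : ℝ) ^ 6 / (β * Real.sqrt β)))) ≤ ε := by
  have hε' : 0 < ε / 2 := by positivity
  obtain h₁ := budget_monomial (a := -(3 / 2)) (k := 14) (j := 0) (κ₃ := κ₃) hθ (by push_cast; linarith) hε' (C / 6) (m + 2)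
  obtain h₂ := budget_monomial (a := -1) (k := 14) (j := 3) (κ₃ := κ₃) hθ (by push_cast; linarith) hε' (C / 6) m
  obtain ⟨β₀, hβ₀, hall⟩ := exists_forall_and h₁ h₂
  refine ⟨β₀, hβ₀, fun β hβ H hH hHβ => ?_⟩
  obtain ⟨e₁, e₂⟩ := hall β hβ H
  replace e₁ := e₁ hH hHβ; replace e₂ := e₂ hH hHβ
  have hβ1 : 1 ≤ β := hβ₀.trans hβ
  have hβpos : 0 < β := by linarith
  simp only [pow_zero, mul_one] at e₁
  rw [rpow_neg_three_halves_eq hβpos] at e₁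
  rw [Real.rpow_neg_one] at e₂
  rw [k5_shape_eq m hβpos]
  have i1 : C / 6 * (H : ℝ) ^ 14 * (1 + Real.log H) ^ (m + 2) / (β * Real.sqrt β) =
      C / 6 * (H : ℝ) ^ 14 * (1 + Real.log H) ^ (m + 2) * (1 / (β * Real.sqrt β)) := by ring
  have i2 : C / 6 * (H : ℝ) ^ 14 * (1 + Real.log H) ^ m * (β ^ (κ₃ - 1 / 2)) ^ 3 / β =
      C / 6 * (H : ℝ) ^ 14 * (1 + Real.log H) ^ m * (β ^ (κ₃ - 1 / 2)) ^ 3 * β⁻¹ := by ring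
  rw [i1, i2]
  linarith only [e₁, e₂]

end AssemblyBudget

end Summit.QuantumFields.YangMills.Theorems.AllWindowsColdBoxBoxHighLine

end
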